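import Literature.AnabelianGeometry.SemiGraphs.PSCSeparatingCoverings
import Literature.AnabelianGeometry.SemiGraphs.ProSigmaCompletionRestrict
import Literature.AnabelianGeometry.SemiGraphs.SurfaceTypeCoveringsToolkit
import Literature.GroupTheory.CombinatorialGroupTheory.FreeFactorFibredTwist
import HarnessLib

/-!
# [CombGC] Prop. 1.2, proof p. 9: the verticial separating covering at ONE vertex, for vertex groups that are closures of free factors

Mochizuki, *A combinatorial version of the Grothendieck conjecture*, Tohoku Math. J. **59** (2007)
[CombGC], PROOF of Proposition 1.2, author's manuscript p. 9: "if `v₁ ≠ v₂` …, then there exists a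
finite étale … covering `G' → G` whose restriction to the anabelioid `G_{v₂}` is trivial …, but whose
restriction to the anabelioid `G_{v₁}` is nontrivial.  But … by gluing together appropriate finite étale
coverings of the anabelioids `G_v`, `G_e`, one may construct a finite étale covering `G' → G` with the
desired properties" [cite: MochizukiCombGC2007, Prop 1.2 proof p.9].  Typed LEVEL-WISE by abc-iut-w4-d081 as
`PSCDatum.VerticialSeparatingCoverings` (`PSCSeparatingCoverings.lean`, sub-DAG row P12-L01-V; verticial
conjunct of abc-iut FACT-LIST rows F-2829 `SeparatingCoverings` / F-2830 `SeparatingCoveringsHolds Ω`;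
universal closure refuted, instance forms wanted): two DISTINCT level-`V'` vertices
`(v₁, V'γ₁Π_{v₁}) ≠ (v₂, V'γ₂Π_{v₂})` are to be separated by an open `U ≤ V'`, normal in `V'`, with
`γ₂Π_{v₂}γ₂⁻¹ ∩ V' ≤ U` but `γ₁Π_{v₁}γ₁⁻¹ ∩ V' ⊄ U`.

PROOF-ONLY file (abc-iut-f-166 gen 3): the case `v₁ = v₂ = v` — TWO DISTINCT VERTICES OF THE COVERING
OVER THE SAME VERTEX `v` of `G` (`Vγ₁Π_v ≠ Vγ₂Π_v`), which exists at every genuine multi-vertex datum as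
soon as `[Π : VΠ_v] > 1` and is NOT reachable by projecting to a quotient killing a vertex group (all the
`γΠ_vγ⁻¹` are conjugate in `Π`).  Print's "gluing of coverings of the anabelioids `G_v`, `G_e`" is
rendered, for vertex groups of the shape the genuine two-component data have (abc-iut-f-164 / f-165:
`Π_v = cl ι⟨b(S)⟩`, the closure of a FREE FACTOR of the discrete fundamental group along a pro-`Σ`
completion `ι : Γ → Π`; tree convention of `ProSigmaFreeFactorMalnormal.lean`), by the purely
group-theoretic FIBRED TWIST of `Literature/GroupTheory/CombinatorialGroupTheory/FreeFactorFibredTwist.lean`: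
at the discrete level `K = ι⁻¹(V)` a nontrivial `ℤ/ℓ`-character of `Γ_S ∩ K` (`Γ_S ∩ K` is free ≠ 1)
extends to a character of `K` equal to it on `f₁(Γ_S ∩ K)f₁⁻¹` and killing `f₂(Γ_S ∩ K)f₂⁻¹` whenever
`f₁⁻¹f₂ ∉ Γ_S K` — NO Kurosh / Bass–Serre subgroup theorem, no Reidemeister–Schreier — and its kernel is
the trace of the required open `U ⊴ V` (`V` is the pro-`Σ` completion of `K`:
`IsProSigmaCompletion.restrict`, `exists_isOpen_comap_subgroupComap_eq`).

* `IsProSigmaCompletion.freeFactor_exists_open_separating_sameVertex` — the clause for an abstract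
  closed subgroup `A = cl ι⟨b(S)⟩`, `S ≠ ∅`, `ℓ ∈ Σ`, AT THE LEVEL `V` ITSELF (`V' := V`);
* `PSCDatum.exists_sameVertex_separating_of_freeFactor` — the same for `Π_v` of a `PSCDatum`;
* `PSCDatum.verticialSeparatingCoverings_of_freeFactors` — row P12-L01-V for a datum ALL of whose vertex
  groups are closures of free factors (one free basis of `Γ` per vertex), GIVEN the separation of level
  vertices over DISTINCT vertices of `G` (the cross-vertex case, reachable by projection; supplied by the
  consumer's shape).

Instance forms at data of free-factor shape; not the printed statement for all pointed stable curves
(cell FOUNDATIONS rows 13–14).  0 definitions; nothing here takes a side on [IUTchIII] Cor. 3.12.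
-/

noncomputable section

namespace Literature.AnabelianGeometry.SemiGraphs

open scoped Pointwise
open Literature.AnabelianGeometry.Anabelioids (IsSigmaInteger)
open Literature.GroupTheory.CombinatorialGroupTheory
open Literature.GroupTheory.CombinatorialGroupTheory.FreeFactorFibredTwist
  (exists_normal_index_eq_separating_of_freeFactor freeFactor_inf_ne_bot)

universe u

/-! ### Bookkeeping: conjugates inside a normal open level -/

section Bookkeeping

variable {P : Type*} [Group P]

/-- `f (a H a⁻¹) = f(a) f(H) f(a)⁻¹`. [folklore] -/
private theorem map_toConjAct_smul' {Γ : Type*} [Group Γ] (f : Γ →* P) (a : Γ) (H : Subgroup Γ) :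
    (ConjAct.toConjAct a • H).map f = ConjAct.toConjAct (f a) • H.map f := by
  rw [← map_conj_eq_conjAct_smul, ← map_conj_eq_conjAct_smul, Subgroup.map_map, Subgroup.map_map]
  congr 1
  ext x
  simp [MulAut.conj_apply]

/-- The image in `Π` of a subgroup `U'` normal in `V` is stable under conjugation by `V`. [folklore] -/
private theorem conjAct_smul_map_subtype_of_mem' {V : Subgroup P} (U' : Subgroup V) [hU : U'.Normal]
    {t : P} (ht : t ∈ V) : ConjAct.toConjAct t • U'.map V.subtype = U'.map V.subtype := by
  ext x
  rw [Subgroup.mem_pointwise_smul_iff_inv_smul_mem, ← map_inv, ConjAct.smul_def,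
    ConjAct.ofConjAct_toConjAct, inv_inv]
  constructor
  · intro hx
    obtain ⟨u, hu, hux⟩ := Subgroup.mem_map.mp hx
    refine Subgroup.mem_map.mpr ⟨⟨t, ht⟩ * u * ⟨t, ht⟩⁻¹, hU.conj_mem u hu ⟨t, ht⟩, ?_⟩
    have hux' : (u : P) = t⁻¹ * x * t := hux
    change ((⟨t, ht⟩ * u * ⟨t, ht⟩⁻¹ : V) : P) = x
    rw [Subgroup.coe_mul, Subgroup.coe_mul, Subgroup.coe_inv, hux']
    group
  · intro hx
    obtain ⟨u, hu, rfl⟩ := Subgroup.mem_map.mp hx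
    refine Subgroup.mem_map.mpr ⟨⟨t, ht⟩⁻¹ * u * ⟨t, ht⟩⁻¹⁻¹, hU.conj_mem u hu ⟨t, ht⟩⁻¹, ?_⟩
    change ((⟨t, ht⟩⁻¹ * u * ⟨t, ht⟩⁻¹⁻¹ : V) : P) = t⁻¹ * (u : P) * t
    rw [inv_inv, Subgroup.coe_mul, Subgroup.coe_mul, Subgroup.coe_inv]

/-- For `U'` normal in `V` and `t ∈ V`: `t B t⁻¹ ⊆ U'` iff `B ⊆ U'` ("trivial over a vertex" does not
depend on the representative, nor on `V`-conjugation). [cite: MochizukiCombGC2007, Def 1.1(ii) p.6] -/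
private theorem conjAct_smul_le_iff' {V : Subgroup P} (U' : Subgroup V) [U'.Normal] {t : P} (ht : t ∈ V)
    (B : Subgroup P) : ConjAct.toConjAct t • B ≤ U'.map V.subtype ↔ B ≤ U'.map V.subtype := by
  conv_lhs => rw [← conjAct_smul_map_subtype_of_mem' U' ht]
  exact Subgroup.pointwise_smul_le_pointwise_smul_iff

end Bookkeeping

/-! ### The same-vertex separating covering for the closure of a free factor -/

namespace SemiGraphOfAnabelioids.IsProSigmaCompletion

variable {Sigma : Set ℕ} {Γ : Type u} [Group Γ] {P : Type u} [Group P] [TopologicalSpace P]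
  [IsTopologicalGroup P] [CompactSpace P] [TotallyDisconnectedSpace P] {ι : Γ →* P}

/-- **[CombGC] Prop. 1.2, proof p. 9 — the verticial separating covering at ONE vertex, free-factor
form.**  Let `ι : Γ → Π` be a pro-`Σ` completion (`Π` profinite) of a free group `Γ` with basis `b`,
`S ⊆ β` nonempty, `A = cl ι⟨b(S)⟩` the closure of the free factor `Γ_S`, `ℓ ∈ Σ` prime, and `V ⊴ Π` open.
For `γ₁, γ₂ ∈ Π` with `Vγ₁A ≠ Vγ₂A` (two DISTINCT level-`V` vertices over the vertex whose group is `A`)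
there is an open `U ≤ V`, normal in `V`, with `γ₂Aγ₂⁻¹ ∩ V ≤ U` ("trivial over the second") and
`γ₁Aγ₁⁻¹ ∩ V ⊄ U` ("nontrivial over the first").  PROOF: `K = ι⁻¹(V)`; the `γᵢ` are `wᵢ·ι(fᵢ)` with
`wᵢ ∈ V`; distinct double cosets force `f₁⁻¹f₂ ∉ Γ_S K`; the fibred twist gives `U' ⊴ K` of index `ℓ`
with `f₁(Γ_S ∩ K)f₁⁻¹ ⊄ U' ⊇ f₂(Γ_S ∩ K)f₂⁻¹`; `V` is the pro-`Σ` completion of `K`, so `U'` is the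
trace of an open `U ⊴ V`, and `γΠ_vγ⁻¹ ∩ V = w·cl ι(f(Γ_S ∩ K)f⁻¹)·w⁻¹`.
[cite: MochizukiCombGC2007, Prop 1.2 proof p.9] -/
theorem freeFactor_exists_open_separating_sameVertex (hι : IsProSigmaCompletion Sigma ι)
    {β : Type*} (b : FreeGroupBasis β Γ) (S : Set β) (hS : S.Nonempty)
    {ℓ : ℕ} (hℓ : ℓ.Prime) (hℓS : ℓ ∈ Sigma)
    (A : Subgroup P) (hA : A = ((Subgroup.closure (b '' S)).map ι).topologicalClosure)
    (V : Subgroup P) [hVn : V.Normal] (hVo : IsOpen (V : Set P)) (γ₁ γ₂ : ConjAct P)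
    (hne : DoubleCoset.doubleCoset (ConjAct.ofConjAct γ₁) (V : Set P) (A : Set P) ≠
      DoubleCoset.doubleCoset (ConjAct.ofConjAct γ₂) (V : Set P) (A : Set P)) :
    ∃ U : Subgroup P, IsOpen (U : Set P) ∧ U ≤ V ∧ (U.subgroupOf V).Normal ∧
      (γ₂ • A) ⊓ V ≤ U ∧ ¬ ((γ₁ • A) ⊓ V ≤ U) := by
  classical
  obtain ⟨AS, hAS⟩ : ∃ AS : Subgroup Γ, AS = Subgroup.closure (b '' S) := ⟨_, rfl⟩
  have hA' : A = (AS.map ι).topologicalClosure := by rw [hA, hAS]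
  -- (A) the discrete level `K = ι⁻¹(V)`, a normal subgroup of finite index of the free group `Γ`
  obtain ⟨K, hK⟩ : ∃ K : Subgroup Γ, K = V.comap ι := ⟨_, rfl⟩
  haveI hKn : K.Normal := by rw [hK]; infer_instance
  haveI : K.FiniteIndex := by rw [hK]; exact finiteIndex_comap hι V hVo
  -- (B) representatives of the two level vertices in `ι(Γ)`, up to `V`
  have stepB : ∀ γ : ConjAct P, ∃ (f : Γ) (w : P), w ∈ V ∧
      (γ • A) ⊓ V = ConjAct.toConjAct w • ((ConjAct.toConjAct (ι f) • A) ⊓ V) ∧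
      DoubleCoset.doubleCoset (ConjAct.ofConjAct γ) (V : Set P) (A : Set P) =
        DoubleCoset.doubleCoset (ι f) (V : Set P) (A : Set P) := by
    intro γ
    obtain ⟨f, hf⟩ := exists_mem_coset hι V hVo (ConjAct.ofConjAct γ)
    have hw : ConjAct.ofConjAct γ * (ι f)⁻¹ ∈ V := by
      have h1 := hVn.conj_mem _ (V.inv_mem hf) (ConjAct.ofConjAct γ)
      simpa [mul_assoc] using h1
    refine ⟨f, ConjAct.ofConjAct γ * (ι f)⁻¹, hw, ?_, ?_⟩
    · rw [Subgroup.smul_inf, conjAct_smul_eq_self_of_mem hw, ← mul_smul, ← map_mul,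
        inv_mul_cancel_right, ConjAct.toConjAct_ofConjAct]
    · exact DoubleCoset.doubleCoset_eq_of_mem (DoubleCoset.mem_doubleCoset.mpr
        ⟨ConjAct.ofConjAct γ * (ι f)⁻¹, hw, 1, A.one_mem, by group⟩)
  obtain ⟨f₁, w₁, hw₁, hA₁, hdc₁⟩ := stepB γ₁
  obtain ⟨f₂, w₂, hw₂, hA₂, hdc₂⟩ := stepB γ₂
  -- the level vertex of `f` seen in `Π`: `ι(f) A ι(f)⁻¹ ∩ V = cl ι(f (Γ_S ∩ K) f⁻¹)`
  have hlevel : ∀ f : Γ, (ConjAct.toConjAct (ι f) • A) ⊓ V =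
      ((ConjAct.toConjAct f • (AS ⊓ K)).map ι).topologicalClosure := by
    intro f
    rw [hA', ← topologicalClosure_conjAct_smul, ← map_toConjAct_smul', topologicalClosure_map_inf_of_isOpen
      ι _ V hVo, Subgroup.smul_inf, hKn.conjAct, hK]
  -- (C) distinct level vertices: `f₁⁻¹ f₂ ∉ Γ_S · K`
  have hδ : f₁⁻¹ * f₂ ∉ (AS : Set Γ) * (K : Set Γ) := by
    intro hmem
    obtain ⟨a, ha, k, hk, hak⟩ := Set.mem_mul.mp hmem
    apply hne
    rw [hdc₁, hdc₂]
    symm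
    have hkV : ι k ∈ V := by rw [hK] at hk; exact hk
    have haA : ι a ∈ A := by
      rw [hA']
      exact Subgroup.le_topologicalClosure _ (Subgroup.mem_map_of_mem ι ha)
    refine DoubleCoset.doubleCoset_eq_of_mem (DoubleCoset.mem_doubleCoset.mpr
      ⟨ι f₁ * ι a * ι k * (ι f₁ * ι a)⁻¹, hVn.conj_mem _ hkV (ι f₁ * ι a), ι a, haA, ?_⟩)
    have hf₂ : f₂ = f₁ * (a * k) := by rw [hak, mul_inv_cancel_left]
    rw [hf₂, map_mul, map_mul]
    group
  -- (D) the fibred twist at the discrete level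
  obtain ⟨U', hU'n, hU'idx, hU'not, hU'le⟩ := exists_normal_index_eq_separating_of_freeFactor b S AS hAS
    K (freeFactor_inf_ne_bot b hS AS hAS K) hℓ f₁
  -- (E) `V` is the pro-`Σ` completion of `K`: `U'` is the trace of an open `U₀ ⊴ V`
  subst hK
  haveI := hU'n
  have hU'S : IsSigmaInteger Sigma U'.index := by
    rw [hU'idx]
    exact ⟨hℓ.pos, fun p hp hdvd => ((Nat.prime_dvd_prime_iff_eq hp hℓ).mp hdvd) ▸ hℓS⟩
  have hι' : IsProSigmaCompletion Sigma (ι.subgroupComap V) := restrict hι V hVo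
  obtain ⟨U₀, hU₀o, hU₀c⟩ := exists_isOpen_comap_subgroupComap_eq hι V hVo U' hU'S
  haveI hU₀n : U₀.Normal := normal_of_comap_normal hι' U₀ hU₀o (by rw [hU₀c]; exact hU'n)
  have hUo : IsOpen ((U₀.map V.subtype : Subgroup P) : Set P) := isOpen_map_subtype V hVo U₀ hU₀o
  -- dictionary between `U'.map K.subtype ≤ Γ` and `U₀.map V.subtype ≤ Π`
  have hdict : ∀ {z : Γ} (hz : z ∈ V.comap ι), ι z ∈ U₀.map V.subtype ↔ z ∈ U'.map (V.comap ι).subtype := by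
    intro z hz
    constructor
    · intro h
      obtain ⟨u, hu, huz⟩ := Subgroup.mem_map.mp h
      have hu' : u = ι.subgroupComap V ⟨z, hz⟩ := Subtype.ext huz
      rw [hu', ← Subgroup.mem_comap, hU₀c] at hu
      exact Subgroup.mem_map.mpr ⟨⟨z, hz⟩, hu, rfl⟩
    · intro h
      obtain ⟨u, hu, huz⟩ := Subgroup.mem_map.mp h
      rw [← hU₀c, Subgroup.mem_comap] at hu
      have huz' : (u : Γ) = z := huz
      refine Subgroup.mem_map.mpr ⟨ι.subgroupComap V u, hu, ?_⟩
      change ι (u : Γ) = ι z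
      rw [huz']
  refine ⟨U₀.map V.subtype, hUo, Subgroup.map_subtype_le U₀, ?_, ?_, ?_⟩
  · rw [← Subgroup.comap_subtype, Subgroup.comap_map_eq_self_of_injective V.subtype_injective]
    exact hU₀n
  · -- trivial over the vertex of `f₂`
    rw [hA₂, conjAct_smul_le_iff' U₀ hw₂, hlevel f₂]
    refine Subgroup.topologicalClosure_minimal _ ?_ (Subgroup.isClosed_of_isOpen _ hUo)
    rintro _ ⟨z, hz, rfl⟩
    have hzU : z ∈ U'.map (V.comap ι).subtype := hU'le f₂ hδ hz
    obtain ⟨u, -, huz⟩ := Subgroup.mem_map.mp hzU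
    have hzK : z ∈ V.comap ι := by rw [← huz]; exact u.2
    exact (hdict hzK).mpr hzU
  · -- nontrivial over the vertex of `f₁`
    rw [hA₁, conjAct_smul_le_iff' U₀ hw₁, hlevel f₁]
    intro hle
    apply hU'not
    intro z hz
    have hzK : z ∈ V.comap ι := by
      obtain ⟨x, hx, rfl⟩ := (Subgroup.mem_smul_pointwise_iff_exists _ _ _).mp hz
      rw [ConjAct.smul_def, ConjAct.ofConjAct_toConjAct]
      exact (inferInstance : (V.comap ι).Normal).conj_mem x hx.2 f₁
    have h1 : ι z ∈ U₀.map V.subtype :=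
      hle (Subgroup.le_topologicalClosure _ (Subgroup.mem_map_of_mem ι hz))
    exact (hdict hzK).mp h1

end SemiGraphOfAnabelioids.IsProSigmaCompletion

/-! ### The clause of row P12-L01-V for a `PSCDatum` -/

namespace PSCDatum

open SemiGraphOfAnabelioids (IsProSigmaCompletion)
open SemiGraphOfAnabelioids.IsProSigmaCompletion (freeFactor_exists_open_separating_sameVertex)

variable {Sigma : Set ℕ} {Γ : Type u} [Group Γ] {P : Type u} [Group P] [TopologicalSpace P]
  [IsTopologicalGroup P] [CompactSpace P] [TotallyDisconnectedSpace P] {ι : Γ →* P}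

/-- **Row P12-L01-V at one vertex of free-factor shape.**  For a `PSCDatum` over a profinite pro-`Σ`
completion `ι : Γ → Π` of a free group and a vertex `v` with `Π_v = cl ι⟨b(S)⟩` (`S ≠ ∅`; e.g. both
vertices of the genuine two-component affine data), `ℓ ∈ Σ`: at EVERY open normal level `V`, two distinct
level-`V` vertices `(v, Vγ₁Π_v) ≠ (v, Vγ₂Π_v)` over `v` admit an open `U ≤ V`, normal in `V`, with
`γ₂Π_vγ₂⁻¹ ∩ V ≤ U` and `γ₁Π_vγ₁⁻¹ ∩ V ⊄ U`. [cite: MochizukiCombGC2007, Prop 1.2 proof p.9] -/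
theorem exists_sameVertex_separating_of_freeFactor (hι : IsProSigmaCompletion Sigma ι)
    {β : Type*} (b : FreeGroupBasis β Γ) (S : Set β) (hS : S.Nonempty)
    {ℓ : ℕ} (hℓ : ℓ.Prime) (hℓS : ℓ ∈ Sigma) (G : PSCDatum P) (v : G.graph.V)
    (hv : G.vertGp v = ((Subgroup.closure (b '' S)).map ι).topologicalClosure)
    (V : Subgroup P) [V.Normal] (hVo : IsOpen (V : Set P)) (γ₁ γ₂ : ConjAct P)
    (hne : DoubleCoset.doubleCoset (ConjAct.ofConjAct γ₁) (V : Set P) (G.vertGp v : Set P) ≠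
      DoubleCoset.doubleCoset (ConjAct.ofConjAct γ₂) (V : Set P) (G.vertGp v : Set P)) :
    ∃ U : Subgroup P, IsOpen (U : Set P) ∧ U ≤ V ∧ (U.subgroupOf V).Normal ∧
      (γ₂ • G.vertGp v) ⊓ V ≤ U ∧ ¬ ((γ₁ • G.vertGp v) ⊓ V ≤ U) :=
  freeFactor_exists_open_separating_sameVertex hι b S hS hℓ hℓS (G.vertGp v) hv V hVo γ₁ γ₂ hne

/-- **Row P12-L01-V (`VerticialSeparatingCoverings`, verticial conjunct of F-2829) for data all of whose
vertex groups are closures of free factors**, GIVEN the cross-vertex separation.  If every `Π_v` is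
`cl ι⟨b_v(S_v)⟩` for some free basis `b_v` of `Γ` and `S_v ≠ ∅` (one basis per vertex: the factors of the
two components of a two-component curve are sub-bases of DIFFERENT free bases of `π₁`), and level
vertices over DISTINCT vertices of `G` are separated at every open normal level (projection to the
quotient killing a vertex group — the consumer's shape supplies it), then `G.VerticialSeparatingCoverings`
holds with `V' := V`. [cite: MochizukiCombGC2007, Prop 1.2 proof p.9] -/
theorem verticialSeparatingCoverings_of_freeFactors (hι : IsProSigmaCompletion Sigma ι)
    (hSig : ∃ ℓ ∈ Sigma, ℓ.Prime) {β : Type*} (G : PSCDatum P)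
    (bs : G.graph.V → FreeGroupBasis β Γ) (Ss : G.graph.V → Set β) (hSs : ∀ v, (Ss v).Nonempty)
    (hv : ∀ v, G.vertGp v = ((Subgroup.closure (bs v '' Ss v)).map ι).topologicalClosure)
    (hcross : ∀ (V : Subgroup P), V.Normal → IsOpen (V : Set P) →
      ∀ (v₁ v₂ : G.graph.V) (γ₁ γ₂ : ConjAct P), v₁ ≠ v₂ →
        ∃ U : Subgroup P, IsOpen (U : Set P) ∧ U ≤ V ∧ (U.subgroupOf V).Normal ∧
          (γ₂ • G.vertGp v₂) ⊓ V ≤ U ∧ ¬ ((γ₁ • G.vertGp v₁) ⊓ V ≤ U)) :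
    G.VerticialSeparatingCoverings := by
  intro V hVn hVo
  haveI := hVn
  obtain ⟨ℓ, hℓS, hℓ⟩ := hSig
  refine ⟨V, hVn, hVo, le_rfl, fun v₁ v₂ γ₁ γ₂ hne12 => ?_⟩
  by_cases h : v₁ = v₂
  · subst h
    exact G.exists_sameVertex_separating_of_freeFactor hι (bs v₁) (Ss v₁) (hSs v₁) hℓ hℓS v₁ (hv v₁)
      V hVo γ₁ γ₂ (hne12.resolve_left fun hn => hn rfl)
  · exact hcross V hVn hVo v₁ v₂ γ₁ γ₂ h

end PSCDatum

end Literature.AnabelianGeometry.SemiGraphs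

end
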